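import Literature.AlgebraicGeometry.Motives.MixedHodgeStructureCatHodgeClasses
import HarnessLib

/-!
# `Hodge(H) ↪ Hodge(Gr^W H)`: the natural monomorphism `Hdgᵖ ⟶ Hdgᵖ ∘ Gr^W_{2p}` on `MixedHodgeStructureCat`, an isomorphism in
# non-negative weight

Layer `Literature/AlgebraicGeometry/Motives` (lane `lit-hodgefound`).  Arapura, Lemma 1.1, first item: «There is an injection
`Hodge(H) ↪ Hodge(Gr^W_0 H)`. It is an isomorphism if `H` has nonnegative weight, i.e. `W_{-1}H = 0`.»  The tree proves this UNBUNDLED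
(`MixedHodgeStructure.hodgeClassesToGr`, `hodgeClassesToGr_injective`, `exists_mem_hodgeClasses_toGr_eq`, `hodgeClassesEquivGr`;
`Motives/MixedHodgeStructureHodgeClasses`).  With the functors `hodgeClassesFunctor p : MixedHodgeStructureCat ⥤ ModuleCat ℚ` (g43-#11) and
`gr k : MixedHodgeStructureCat ⥤ HodgeStructureCat k` (g43-#6) this file states it as a morphism of functors:

* the natural transformation **`hodgeClassesToGr p : hodgeClassesFunctor p ⟶ (gr (2p) ⋙ ofPure (2p)) ⋙ hodgeClassesFunctor p`**
  (`v ↦ [v]`; as in Arapura, `Hodge(Gr^W_{2p} H)` is the Hodge classes of the pure `Gr^W_{2p} H` REGARDED AS A MIXED Hodge structure, so that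
  one functor `Hodge(−) = hodgeClassesFunctor p` (g43-#11) appears on both sides), a MONOMORPHISM (componentwise injective: `mono_hodgeClassesToGr_app`, `mono_hodgeClassesToGr`), whose component at `X` is an
  ISOMORPHISM when `W_{2p-1} X = 0` (`isIso_hodgeClassesToGr_app`), in particular at pure objects of weight `2p`
  (`isIso_hodgeClassesToGr_app_ofPure`); consequently `Hdgᵖ(X) = 0` whenever `Hdgᵖ(Gr^W_{2p} X) = 0` (`hodgeClasses_eq_bot_of_gr`).

Definition with body (`hodgeClassesToGr`) and theorems; instances only on this file's own transformation (`Mono`); no notion, no named fact (0 new facts), no notation.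

## Sources, verbatim

* D. Arapura, *Hodge cycles and the Leray filtration*, Pacific J. Math. 319 (2022), §1 (held text arXiv 2103.05038 p0003 L10–L21): «Given a
  mixed Hodge structure `H`, set `Hodge(H) := Hom_MHS(ℚ(0), H)`. … Lemma 1.1. • There is an injection `Hodge(H) ↪ Hodge(Gr^W_0 H)`. It is an
  isomorphism if `H` has nonnegative weight, i.e. `W_{-1}H = 0`.»
* C. Voisin, *Hodge Theory and Complex Algebraic Geometry I* (2002), §7.3.1 Def. 7.22 (morphisms of Hodge structures), §7.1 and §11.3
  (Hodge classes `V ∩ V^{p,p}`).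

## References

* [Arapura2022] D. Arapura, Hodge cycles and the Leray filtration, Pacific J. Math. 319 (2022), §1, Lemma 1.1 (arXiv 2103.05038).
* [VoisinHodgeI2002] C. Voisin, Hodge Theory and Complex Algebraic Geometry I (2002), §7.3.1 Def. 7.22, §11.3.
* [DeligneHodgeII1971] P. Deligne, Théorie de Hodge II, Publ. Math. IHÉS 40 (1971), 2.1, 2.3.1.

## Provenance

Lane `lit-hodgefound` (summit `HodgeConjecture`), seat `lit-hodgefound-p36` (literature-prover, generation 43, row g43-#13).
-/

noncomputable section

open CategoryTheory CategoryTheory.Limits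

namespace Literature.AlgebraicGeometry.Motives

universe u

namespace MixedHodgeStructureCat

/-! ## `Hdgᵖ ⟶ Hdgᵖ ∘ Gr^W_{2p}` -/

/-- A Hodge class of the pure `Gr^W_{2p} X` is a Hodge class of `Gr^W_{2p} X` regarded as an MHS (its `W_{2p}` is everything).
[cite: Arapura2022, §1 Lemma 1.1] -/
theorem mem_hodgeClasses_ofPure_gr_iff (p : ℤ) (X : MixedHodgeStructureCat.{u}) (y : MixedHodgeStructure.grW X.str.W (2 * p)) :
    y ∈ ((ofPure (2 * p)).obj ((gr (2 * p)).obj X)).str.hodgeClasses p ↔ y ∈ (X.str.gr (2 * p)).hodgeClasses p :=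
  (MixedHodgeStructure.mem_hodgeClasses_iff (X.str.gr (2 * p)).toMixedHodgeStructure p y).trans
    ⟨fun h => h.2, fun h => ⟨by
      rw [HodgeStructure.toMixedHodgeStructure_W, HodgeStructure.trivialWeightFiltration_of_le le_rfl]
      exact Submodule.mem_top, h⟩⟩

/-- **The natural transformation `Hdgᵖ(X) → Hdgᵖ(Gr^W_{2p} X)`, `v ↦ [v]`** (a Hodge class of type `(p,p)` lies in `W_{2p}` and its class in
`Gr^W_{2p}` — regarded as an MHS via `ofPure` — is a Hodge class; the tree's `hodgeClassesToGr`, co-restricted). [cite: Arapura2022, §1 Lemma 1.1] -/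
def hodgeClassesToGr (p : ℤ) : hodgeClassesFunctor.{u} p ⟶ (gr (2 * p) ⋙ ofPure (2 * p)) ⋙ hodgeClassesFunctor p where
  app X := ModuleCat.ofHom ((X.str.hodgeClassesToGr p).codRestrict (((ofPure (2 * p)).obj ((gr (2 * p)).obj X)).str.hodgeClasses p)
    fun v => (mem_hodgeClasses_ofPure_gr_iff p X _).2 (X.str.hodgeClassesToGr_mem p v))
  naturality _ _ _ := by
    ext
    rfl

/-- The component of `hodgeClassesToGr p` at `X` on `v` is the class `[v] ∈ Gr^W_{2p} X`. [cite: Arapura2022, §1 Lemma 1.1] -/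
@[simp]
theorem coe_hodgeClassesToGr_app_apply (p : ℤ) (X : MixedHodgeStructureCat.{u}) (v : X.str.hodgeClasses p) :
    Subtype.val (((hodgeClassesToGr p).app X).hom v) = X.str.hodgeClassesToGr p v := rfl

/-- **`Hodge(H) ↪ Hodge(Gr^W H)`**: the components of `hodgeClassesToGr p` are injective. [cite: Arapura2022, §1 Lemma 1.1] -/
theorem hodgeClassesToGr_app_injective (p : ℤ) (X : MixedHodgeStructureCat.{u}) : Function.Injective ((hodgeClassesToGr p).app X).hom :=
  fun _ _ h => X.str.hodgeClassesToGr_injective p (congrArg Subtype.val h)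

/-- The components of `hodgeClassesToGr p` are monomorphisms. [cite: Arapura2022, §1 Lemma 1.1] -/
instance mono_hodgeClassesToGr_app (p : ℤ) (X : MixedHodgeStructureCat.{u}) : Mono ((hodgeClassesToGr p).app X) :=
  (ModuleCat.mono_iff_injective _).2 (hodgeClassesToGr_app_injective p X)

/-- **`hodgeClassesToGr p` is a monomorphism of functors.** [cite: Arapura2022, §1 Lemma 1.1] -/
instance mono_hodgeClassesToGr (p : ℤ) : Mono (hodgeClassesToGr.{u} p) := NatTrans.mono_of_mono_app _

/-- The components of `hodgeClassesToGr p` are surjective when `W_{2p-1} X = 0`. [cite: Arapura2022, §1 Lemma 1.1] -/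
theorem hodgeClassesToGr_app_surjective (p : ℤ) {X : MixedHodgeStructureCat.{u}} (h : X.str.W (2 * p - 1) = ⊥) :
    Function.Surjective ((hodgeClassesToGr p).app X).hom := by
  rintro ⟨y, hy⟩
  obtain ⟨v, hv⟩ := X.str.exists_mem_hodgeClasses_toGr_eq h ((mem_hodgeClasses_ofPure_gr_iff p X y).1 hy)
  exact ⟨v, Subtype.ext hv⟩

/-- **`Hodge(H) ≅ Hodge(Gr^W H)` in non-negative weight**: if `W_{2p-1} X = 0` the component of `hodgeClassesToGr p` at `X` is an isomorphism.
[cite: Arapura2022, §1 Lemma 1.1] -/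
theorem isIso_hodgeClassesToGr_app (p : ℤ) {X : MixedHodgeStructureCat.{u}} (h : X.str.W (2 * p - 1) = ⊥) : IsIso ((hodgeClassesToGr p).app X) := by
  change IsIso (LinearEquiv.ofBijective ((hodgeClassesToGr p).app X).hom
    ⟨hodgeClassesToGr_app_injective p X, hodgeClassesToGr_app_surjective p h⟩).toModuleIso.hom
  infer_instance

/-- At a PURE object of weight `2p` the comparison `Hdgᵖ(X) → Hdgᵖ(Gr^W_{2p} X)` is an isomorphism. [cite: Arapura2022, §1 Lemma 1.1]
[cite: VoisinHodgeI2002, §11.3] -/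
theorem isIso_hodgeClassesToGr_app_ofPure (p : ℤ) (Y : HodgeStructureCat.{u} (2 * p)) : IsIso ((hodgeClassesToGr p).app ((ofPure (2 * p)).obj Y)) :=
  isIso_hodgeClassesToGr_app p ((isPure_ofPure_obj Y).1 (2 * p - 1) (by omega))

/-- More generally the comparison is an isomorphism at every object pure of weight `2p`. [cite: Arapura2022, §1 Lemma 1.1] -/
theorem isIso_hodgeClassesToGr_app_of_isPure (p : ℤ) {X : MixedHodgeStructureCat.{u}} (hX : X.str.IsPure (2 * p)) :
    IsIso ((hodgeClassesToGr p).app X) :=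
  isIso_hodgeClassesToGr_app p (hX.1 (2 * p - 1) (by omega))

/-- **`Hdgᵖ(X) = 0` as soon as `Hdgᵖ(Gr^W_{2p} X) = 0`** (injectivity of the comparison). [cite: Arapura2022, §1 Lemma 1.1] -/
theorem hodgeClasses_eq_bot_of_gr (p : ℤ) {X : MixedHodgeStructureCat.{u}} (h : ((gr (2 * p)).obj X).str.hodgeClasses p = ⊥) :
    X.str.hodgeClasses p = ⊥ := by
  rw [Submodule.eq_bot_iff]
  intro v hv
  have h0 : X.str.hodgeClassesToGr p ⟨v, hv⟩ = 0 := by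
    have hmem : X.str.hodgeClassesToGr p ⟨v, hv⟩ ∈ ((gr (2 * p)).obj X).str.hodgeClasses p := X.str.hodgeClassesToGr_mem p ⟨v, hv⟩
    rw [h] at hmem
    exact (Submodule.mem_bot ℚ).1 hmem
  have := X.str.hodgeClassesToGr_injective p (h0.trans (map_zero _).symm)
  exact congrArg Subtype.val this

/-- Hence `Hom(ℚ(-p), X) = 0` as soon as `Gr^W_{2p} X` has no Hodge classes of type `(p,p)`. [cite: Arapura2022, §1 Lemma 1.1] -/
theorem subsingleton_tateObj_hom_of_gr (p : ℤ) {X : MixedHodgeStructureCat.{u}} (h : ((gr (2 * p)).obj X).str.hodgeClasses p = ⊥) :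
    Subsingleton (tateObj.{u} (-p) ⟶ X) :=
  subsingleton_tateObj_hom p (hodgeClasses_eq_bot_of_gr p h)

end MixedHodgeStructureCat

end Literature.AlgebraicGeometry.Motives

end
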